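import Summits.BirchSwinnertonDyer.BirchSwinnertonDyer.Theorems.AlignedTransportAtTwoMainConjectureOfRankZeroBSDAtTwoSexticTowerLambda
import Summits.BirchSwinnertonDyer.BirchSwinnertonDyer.Theorems.AlignedTransportAtTwoMainConjectureOfRankZeroBSDAtTwoCubicOffStratumPrimes
import Literature.NumberTheory.NumberFields.TorsionOrderOfTwoAdicEmbedding
import Literature.NumberTheory.NumberFields.AmbiguousClassGenusLowerBound
import Literature.NumberTheory.IwasawaTheory.FukudaRankCountingLemmas
import Literature.NumberTheory.GaloisRepresentations.SplitsCompletelyCriteria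
import HarnessLib

/-!
# Route `AlignedTransportAtTwo`, crux C2 `MainConjectureOfRankZeroBSDAtTwo` (stmt-BirchSwinnertonDyer-22298):
# GENUS THEORY IN RANK FORM ALONG THE `ℤ₂`-TOWER — `m·n ≤ n·rank₂ Cl(K_n) + n + n·u + log₂ #μ(K)` — and `#μ = 2` from ONE `2`-adic place;
# on the Kilford sub-cell the sextic `ℚ(W[2])` has `rank₂ Cl(ℚ(W[2])₁) ≥ 2` and `rank₂ Cl(ℚ(W[2])_n) ≥ 3` for `n ≥ 2`

HONEST FRAMING (cell `bsd-f1-sign2`, WIDTH-5 attached prover seat `bsd-line-att-p3` gen 27, line `birth`, lead `bsd-line-att-p2`; `--supports`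
stmt-BirchSwinnertonDyer-22298, closes nothing; BSD is NOT proved; crux C2, its verdict «blocked-on `Rank1Residual.GreenbergMuConjectureIrreducible`» and every
registered stub (P / T / Kμ / LimDoor / MuIneqʳ / PFμ⁺) untouched).  THEOREMS ONLY — no definition, no named fact, no `sorry`.  Sequel of this seat's g25/g26
«Chevalley along the whole tower» (`…ZpTowerChevalleyGrowth` p751162: `e_0 + s·n ≤ e_n + n + n·u + log₂ #μ(K)`; `…SexticTowerGrowth/Lambda` p753078/p753117:
the `S₃`-sextic `ℚ(W[2])` ON the Kilford stratum has `s = 6`, `u = 2`, class-NUMBER certificates void, `μ = 0 ⟹ λ ≥ 3`), answering its successor items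
(a) «RANK-form genus bound on the sextic» and (d) «kernel `#μ(ℚ(W[2])) = 2`» (REF1 §280 rider R280a), with two new Literature files of this gen:
`Literature/NumberTheory/NumberFields/TorsionOrderOfTwoAdicEmbedding.lean` (p755489: `K → ℚ₂` ⟹ `torsionOrder K = 2`) and
`Literature/NumberTheory/NumberFields/AmbiguousClassGenusLowerBound.lean` (p755814: `∏ e_𝔭 ≤ [Cl(L) : Cl(L)^d·I_σ]·d·[E_K : E_K ∩ N Lˣ]`, `#(B/N) ≤ [B:B^ℓ]ⁿ`).

* §0 `#μ = 2` FROM ONE `2`-ADIC PLACE (any number field): **`torsionOrder_eq_two_of_exists_prime`** (a height-one prime `w ∋ 2` with `e = f = 1` ⟹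
  `torsionOrder K = 2`, via att-p5 g26 `exists_ringHom_padic_of_ramificationIdx_eq_one_of_inertiaDeg_eq_one`), **`torsionOrder_eq_two_of_splitsCompletely_two`**
  (e.g. the Greenberg field of cell bsd-2adic), **`torsionOrder_divisionField_two_eq_two`** (the sextic `ℚ(W[2])` ON the Kilford stratum) and the
  R280a KERNEL form **`classNumberPExp_zero_add_three_mul_le_layer_succ_divisionField_two`**: `e_0 + 3n ≤ e_n + 1` (`e_1 ≥ e_0 + 2`, `e_2 ≥ e_0 + 5`).
* §1 THE TOWER IN RANK FORM (any base field `K` with `√2 ∈ K_1`, all places above `2` of odd index, `m ≤ #{w ∣ 2}`, `n ≥ 1`):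
  **`mul_le_mul_classGroupPRank_layer_add`** — **`m·n ≤ n·rank₂ Cl(K_n) + n + n·u_K + log₂ #μ(K)`**: `2^{mn} ∣ ∏ e_𝔭(K_n/K)` (p751162) `≤`
  `[Cl(K_n) : Cl(K_n)^{2ⁿ}·I_σ] · 2ⁿ · [E_K : E_K ∩ N]` (p755814) with `[E_K : E_K ∩ N] ∣ [E_K : E_K^{2ⁿ}] ≤ #μ·2^{nu}` (p751162) and
  `[Cl(K_n) : Cl(K_n)^{2ⁿ}·I_σ] ≤ [Cl(K_n) : Cl(K_n)²]ⁿ = 2^{n·rank₂}` (p755814, exponent `2ⁿ`); readings with `#μ(K) = 2`: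
  **`rank₂ Cl(K_1) ≥ m − 2 − u`** (`le_classGroupPRank_layer_one_add`), **`rank₂ Cl(K_n) ≥ m − 1 − u` for `n ≥ 2`** (`le_classGroupPRank_layer_add_of_two_le`);
  `θ`-free / `K → ℚ₂` forms.
* §2 THE SEXTIC `T = ℚ(W[2])` ON THE KILFORD STRATUM (`W` with no rational `2`-torsion abscissa, `Δ_W < 0`; `m = 6`, `u = 2`, `#μ = 2`), every cyclotomic
  `ℤ₂`-extension `κ`: ★ **`two_le_classGroupPRank_layer_one_divisionField_two`** (`rank₂ Cl(T_1) ≥ 2`), ★ **`three_le_classGroupPRank_layer_divisionField_two`**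
  (`rank₂ Cl(T_n) ≥ 3`, `n ≥ 2`); CONSEQUENCE for the only admissible `μ`-certificate shape on the Kilford sub-cell (2-RANK stabilisation, g26/R280c):
  **`two_le_classGroupPRank_zero_of_rankCert_zero`** (a layer-(0,1) certificate `r_0 = r_1` needs `rank₂ Cl(ℚ(W[2])) ≥ 2`) and
  **`three_le_classGroupPRank_of_rankCert_succ`** (`r_n = r_{n+1}`, `n ≥ 1`, needs `r_n ≥ 3`); bsd-potss door L10 at `(p, j) = (2, 2)` («`rank₂ Cl(K_2) < 3`»,
  tree `classGroupPRank_le_of_lt_pow_sub_one`) is VOID on the sextic (`not_classGroupPRank_layer_two_lt_three_divisionField_two`); `Δ_min ≡ 1 (mod 8)` forms.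

READING.  Only the sextic among a Kilford seed's three fields makes rank-genus theory bite (`m − 1 − u = 3`; cubic `ℚ(e₁)`: `3 − 1 − 1 = 1`; resolvent
`ℚ(√Δ_W)`: `2 − 1 − 0 = 1`), exactly as for class numbers (g25/g26).  CENSUS ASK sharpened (-data; kit_allowed=false here): `rank₂ Cl(ℚ(W[2]))` for the 12
certified seeds decides whether the degree-6/12 pair `(T, T(√2))` can carry a certificate at all (`r_0 ≥ 2` needed; `r_1 ≥ 2` is automatic and `r_1 = r_2`
needs `r_1 ≥ 3`).  Nothing here is specific to BSD; no class group is computed.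
References: [Gras2003] IV.4; [Lang1990] Ch. 13 §4 L4.1–4.2; [Washington1997] §13.1, §13.3 Prop. 13.22–13.23, Thm. 13.13; [Fukuda1994] Thm. 1 (2);
[NeukirchANT1999] Ch. II §5 (5.7), Ch. II §8; [Gouvea1993PadicNumbers] §5.7.
-/

set_option linter.dupNamespace false
set_option autoImplicit false

noncomputable section
open scoped Classical NumberField nonZeroDivisors
namespace Summit.BirchSwinnertonDyer.BirchSwinnertonDyer.Theorems.AlignedTransportAtTwoSexticTowerRank

open NumberField IsDedekindDomain WeierstrassCurve
open Literature.NumberTheory.EllipticCurves.Greenberg1999 Summit.BirchSwinnertonDyer.Rank1Residual.F1Sign2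
open Literature.NumberTheory.NumberFields Literature.NumberTheory.NumberFields.AmbiguousClass
  Literature.NumberTheory.GaloisRepresentations
  Literature.NumberTheory.GaloisRepresentations.Herbrand Literature.NumberTheory.GaloisRepresentations.MinkowskiUnit
  Literature.NumberTheory.GaloisRepresentations.CyclicNormIndex Literature.NumberTheory.IwasawaTheory
  Literature.NumberTheory.EllipticCurves
  Summit.BirchSwinnertonDyer.BirchSwinnertonDyer.Theorems.AlignedTransportAtTwoCubicLayerOneParity
  Summit.BirchSwinnertonDyer.BirchSwinnertonDyer.Theorems.AlignedTransportAtTwoCubicTowerGrowth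
  Summit.BirchSwinnertonDyer.BirchSwinnertonDyer.Theorems.AlignedTransportAtTwoZpTowerMonotone
  Summit.BirchSwinnertonDyer.BirchSwinnertonDyer.Theorems.AlignedTransportAtTwoZpTowerChevalleyGrowth
  Summit.BirchSwinnertonDyer.BirchSwinnertonDyer.Theorems.AlignedTransportAtTwoSexticTowerGrowth
  Summit.BirchSwinnertonDyer.BirchSwinnertonDyer.Theorems.AlignedTransportAtTwoSexticTowerLambda
  Summit.BirchSwinnertonDyer.BirchSwinnertonDyer.Theorems.AlignedTransportAtTwoCubicOffStratumPrimes

/-! ## §0 `#μ(K) = 2` from ONE `2`-adic place of degree one; the sextic; R280a kernel -/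

section TorsionOrder

variable {K : Type} [Field K] [NumberField K]

/-- **A number field with a prime above `2` of ramification index `1` and residue degree `1` has `μ(K) = {±1}`** (`torsionOrder K = 2`): such a prime
is an embedding `K → ℚ₂` (att-p5 g26 `exists_ringHom_padic_of_ramificationIdx_eq_one_of_inertiaDeg_eq_one`) and `μ(ℚ₂) = {±1}` (p755489).
[cite: NeukirchANT1999, Ch. II §5 Prop. (5.7) and §8 (8.3)] -/
theorem torsionOrder_eq_two_of_exists_prime (w : HeightOneSpectrum (𝓞 K)) (hw : ((2 : ℕ) : 𝓞 K) ∈ w.asIdeal)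
    (he : w.asIdeal.ramificationIdx ℤ = 1) (hf : w.asIdeal.inertiaDeg ℤ = 1) : Units.torsionOrder K = 2 := by
  haveI : Fact (Nat.Prime 2) := ⟨Nat.prime_two⟩
  obtain ⟨σ, -⟩ := exists_ringHom_padic_of_ramificationIdx_eq_one_of_inertiaDeg_eq_one (p := 2) w hw he hf
  exact torsionOrder_eq_two_of_ringHom_padicTwo σ

/-- **`2` split completely in `K` ⟹ `torsionOrder K = 2`** (e.g. the imaginary quadratic Greenberg field of cell bsd-2adic, `ℚ(i)` and `ℚ(√−3)` excluded
automatically). [cite: NeukirchANT1999, Ch. II §5 Prop. (5.7)] [cite: Marcus2018, Ch. 3 Thm. 21] -/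
theorem torsionOrder_eq_two_of_splitsCompletely_two (h2 : SplitsCompletely K 2) : Units.torsionOrder K = 2 := by
  -- a prime above `2` exists
  haveI : (Ideal.span {(2 : ℤ)}).IsMaximal := Int.ideal_span_isMaximal_of_prime 2
  obtain ⟨P, hPmax, hPover⟩ := Ideal.exists_maximal_ideal_liesOver_of_isIntegral (S := 𝓞 K) (Ideal.span {(2 : ℤ)})
  have h20 : Ideal.span {(2 : ℤ)} ≠ ⊥ := by
    rw [ne_eq, Ideal.span_singleton_eq_bot]; norm_num
  have hP0 : P ≠ ⊥ := Ideal.ne_bot_of_liesOver_of_ne_bot (p := Ideal.span {(2 : ℤ)}) h20 P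
  set w : HeightOneSpectrum (𝓞 K) := ⟨P, hPmax.isPrime, hP0⟩
  have hw : ((2 : ℕ) : 𝓞 K) ∈ w.asIdeal := natCast_mem_of_liesOver_span hPover
  haveI : w.asIdeal.IsPrime := w.isPrime
  haveI : w.asIdeal.LiesOver (Ideal.span {(2 : ℤ)}) := hPover
  have he : w.asIdeal.ramificationIdx ℤ = 1 :=
    (Algebra.isUnramifiedIn_iff_forall_ramificationIdx_eq_one.mp h2.1) w.asIdeal inferInstance
  have hf : w.asIdeal.inertiaDeg ℤ = 1 :=
    ((splitsCompletely_iff_forall_inertiaDeg_eq_one Nat.prime_two).mp h2).2 P ⟨hPmax.isPrime, hPover⟩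
  exact torsionOrder_eq_two_of_exists_prime w hw he hf

variable (W : WeierstrassCurve ℚ) [W.IsElliptic]

/-- **`#μ(ℚ(W[2])) = 2` ON the Kilford stratum** (REF1 R280a, now kernel): `ℚ(W[2])` embeds into `ℚ₂` there (g26 `nonempty_algHom_divisionField_two_padic`),
so its only roots of unity are `±1` (p755489). [cite: NeukirchANT1999, Ch. II §5 Prop. (5.7)] -/
theorem torsionOrder_divisionField_two_eq_two (hs : OnKilfordStratumAtTwo W) :
    haveI : NumberField (W.divisionField 2) := NumberField.mk
    Units.torsionOrder (W.divisionField 2) = 2 := by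
  haveI : NumberField (W.divisionField 2) := NumberField.mk
  exact torsionOrder_eq_two_of_nonempty_algHom_padicTwo (nonempty_algHom_divisionField_two_padic W hs)

/-- **R280a KERNEL: `e_0 + 3n ≤ e_n + 1` along every cyclotomic `ℤ₂`-extension of `ℚ(W[2])`** (`W` with no rational `2`-torsion abscissa, `Δ_W < 0`, ON the
Kilford stratum) — g26's `e_0 + 3n ≤ e_n + log₂ #μ` with `#μ = 2`: `e_1 ≥ e_0 + 2`, `e_2 ≥ e_0 + 5`, …. [cite: Lang1990, Ch. 13 §4, Lemma 4.1–4.2]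
[cite: Washington1997, §13.1] -/
theorem classNumberPExp_zero_add_three_mul_le_layer_succ_divisionField_two (ht : ∀ x : ℚ, ¬ HasRationalTwoTorsionX W x) (hΔ : W.Δ < 0)
    (hs : OnKilfordStratumAtTwo W) (κ : ZpExtension (W.divisionField 2) 2) (hκ : κ.IsCyclotomic) (n : ℕ) :
    classNumberPExp κ 0 + 3 * n ≤ classNumberPExp κ n + 1 := by
  haveI : NumberField (W.divisionField 2) := NumberField.mk
  have h := classNumberPExp_zero_add_le_layer_divisionField_two W ht hΔ hs κ hκ n
  rw [torsionOrder_divisionField_two_eq_two W hs, show Nat.log 2 2 = 1 by decide] at h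
  exact h

end TorsionOrder

/-! ## §1 The `ℤ₂`-tower in RANK form: `m·n ≤ n·rank₂ Cl(K_n) + n + n·u + log₂ #μ(K)` -/

section Tower

variable {K : Type} [Field K] [NumberField K]

/-- `[Cl(K_n) : Cl(K_n)²] = 2 ^ rank₂ Cl(K_n)` (the tree's `classGroupPRank` currency; the index is a power of `2`).
[cite: Fukuda1994, p. 264 (definition of `rank(M)`)] -/
theorem index_range_pow_layer_eq_two_pow (κ : ZpExtension K 2) (n : ℕ) :
    (powMonoidHom 2 : ClassGroup (𝓞 (κ.layer n)) →* ClassGroup (𝓞 (κ.layer n))).range.index = 2 ^ classGroupPRank κ n := by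
  haveI : Fact (Nat.Prime 2) := ⟨Nat.prime_two⟩
  haveI : FiniteDimensional K (κ.layer n) := κ.finiteDimensional_layer_holds n
  haveI : NumberField (κ.layer n) := NumberField.of_module_finite K _
  obtain ⟨c, hc⟩ := index_range_powMonoidHom_eq_prime_pow (K := ↥(κ.layer n)) 2
  rw [classGroupPRank_def, ← Subgroup.index_eq_card, hc, padicValNat.prime_pow]

/-- ★ **THE TOWER IN RANK FORM.**  `κ` a `ℤ₂`-extension of the number field `K` with `√2 ∈ K_1`, every place above `2` of odd absolute index,
`m ≤ #{w ∣ 2}`, `n ≥ 1`: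

  **`m·n ≤ n · rank₂ Cl(K_n) + n + n·u_K + log₂ #μ(K)`.**

Proof: `2^{mn} ∣ ∏_𝔭 e_𝔭(K_n/K)` (total ramification, p751162) `≤ [Cl(K_n) : Cl(K_n)^{2ⁿ}·I_σ] · 2ⁿ · [E_K : E_K ∩ N]` (lower genus bound with Chevalley, p755814);
`[E_K : E_K ∩ N] ∣ [E_K : E_K^{2ⁿ}] = 2^k`, `k ≤ n·u + log₂ #μ` (Dirichlet, p751162); the quotient `Cl(K_n)/(Cl^{2ⁿ}·I_σ)` is killed by `2ⁿ`, so its order is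
`≤ [Cl(K_n) : Cl(K_n)²]ⁿ = 2^{n·rank₂}` (p755814).  [cite: Gras2003, IV.4] [cite: Lang1990, Ch. 13 §4, Lemma 4.1–4.2] [cite: Washington1997, §13.3 Prop. 13.22–13.23] -/
theorem mul_le_mul_classGroupPRank_layer_add (κ : ZpExtension K 2) {θ₁ : κ.layer 1} (hθ₁ : θ₁ ^ 2 = 2)
    (hodd : ∀ w : HeightOneSpectrum (𝓞 K), ((2 : ℕ) : 𝓞 K) ∈ w.asIdeal → Odd (w.asIdeal.ramificationIdx ℤ))
    {m : ℕ} (hm : m ≤ {w : HeightOneSpectrum (𝓞 K) | ((2 : ℕ) : 𝓞 K) ∈ w.asIdeal}.ncard) {n : ℕ} (hn : 1 ≤ n) :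
    m * n ≤ n * classGroupPRank κ n + (n + n * Units.rank K + Nat.log 2 (Units.torsionOrder K)) := by
  haveI : Fact (Nat.Prime 2) := ⟨Nat.prime_two⟩
  haveI : FiniteDimensional K (κ.layer n) := κ.finiteDimensional_layer_holds n
  haveI : IsGalois K (κ.layer n) := κ.isGalois_layer_holds n
  haveI : NumberField (κ.layer n) := NumberField.of_module_finite K _
  haveI : IsCyclic ((κ.layer n) ≃ₐ[K] (κ.layer n)) := isCyclic_aut_layer κ n
  have hdeg : Module.finrank K (κ.layer n) = 2 ^ n := κ.finrank_layer_holds n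
  obtain ⟨σ, hσ⟩ := IsCyclic.exists_generator (α := (κ.layer n) ≃ₐ[K] (κ.layer n))
  set L := ↥(κ.layer n)
  set X := ((powMonoidHom (Module.finrank K L) : ClassGroup (𝓞 L) →* ClassGroup (𝓞 L)).range ⊔
        ((ClassGroup.mulEquiv (intAut σ)).toMonoidHom / MonoidHom.id (ClassGroup (𝓞 L))).range).index with hX
  set U := (unitsE L ⊓ (⊤ : Subgroup Lˣ).map (Herbrand.norm (L ≃ₐ[K] L))).relIndex (unitsE L ⊓ (unitsIncl K L).range) with hU
  set E := (∏ᶠ v : HeightOneSpectrum (𝓞 K), v.asIdeal.ramificationIdxIn (𝓞 L)) with hE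
  -- (1) lower genus bound with Chevalley: `E ≤ X * d * U`
  have h1 : E ≤ X * Module.finrank K L * U := finprod_ramificationIdxIn_le hσ
  -- (2) `E > 0` (Chevalley's left-hand side is positive) and `2^{mn} ∣ E`
  have hChev := ambiguousClassNumberFormula hσ
  have hEpos : 0 < E := by
    have hF : 0 < Nat.card {c : ClassGroup (𝓞 L) // ∀ τ : L ≃ₐ[K] L, ClassGroup.mulEquiv (intAut τ) c = c} := by
      haveI : Nonempty {c : ClassGroup (𝓞 L) // ∀ τ : L ≃ₐ[K] L, ClassGroup.mulEquiv (intAut τ) c = c} :=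
        ⟨⟨1, fun τ => map_one _⟩⟩
      exact Nat.card_pos
    have hl : 0 < Nat.card {c : ClassGroup (𝓞 L) // ∀ τ : L ≃ₐ[K] L, ClassGroup.mulEquiv (intAut τ) c = c} *
        Module.finrank K L * U := Nat.mul_pos (Nat.mul_pos hF Module.finrank_pos) (Nat.pos_of_ne_zero (relIndex_unitsNorm_ne_zero hσ).1)
    rw [hChev] at hl
    exact Nat.pos_of_mul_pos_left (Nat.pos_of_mul_pos_right hl)
  have h2 : 2 ^ (m * n) ≤ E := Nat.le_of_dvd hEpos (pow_dvd_finprod_ramificationIdxIn_layer_of_sq_eq_two κ hθ₁ hodd hm hn)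
  -- (3) `U ≤ 2^(n u + log₂ #μ)`
  obtain ⟨k, hk, hkle⟩ := exists_relIndex_map_pow_eq_pow (K := K) (L := L) (p := 2) n
  have hU2 : U ≤ 2 ^ (n * Units.rank K + Nat.log 2 (Units.torsionOrder K)) := by
    have hdvd : U ∣ ((unitsE L ⊓ (unitsIncl K L).range).map (powMonoidHom (Module.finrank K L))).relIndex
        (unitsE L ⊓ (unitsIncl K L).range) := Subgroup.relIndex_dvd_of_le_left _ map_pow_unitsK_le
    rw [hdeg, hk] at hdvd
    exact (Nat.le_of_dvd (pow_pos two_pos k) hdvd).trans (Nat.pow_le_pow_right two_pos hkle)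
  -- (4) `X ≤ (2 ^ rank)ⁿ`: the quotient is killed by `2ⁿ`
  have hX2 : X ≤ (2 ^ classGroupPRank κ n) ^ n := by
    have hN : ∀ b : ClassGroup (𝓞 L), b ^ 2 ^ n ∈
        (powMonoidHom (Module.finrank K L) : ClassGroup (𝓞 L) →* ClassGroup (𝓞 L)).range ⊔
          ((ClassGroup.mulEquiv (intAut σ)).toMonoidHom / MonoidHom.id (ClassGroup (𝓞 L))).range := fun b =>
      Subgroup.mem_sup_left ⟨b, by rw [powMonoidHom_apply, hdeg]⟩
    have h := card_quotient_le_index_range_pow_pow _ 2 n hN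
    rw [index_range_pow_layer_eq_two_pow κ n] at h
    exact h
  -- (5) assemble: `2^{mn} ≤ 2^{n·rank + n + n·u + log₂ #μ}`
  have h5 : 2 ^ (m * n) ≤ 2 ^ (n * classGroupPRank κ n + (n + n * Units.rank K + Nat.log 2 (Units.torsionOrder K))) := by
    calc 2 ^ (m * n) ≤ E := h2
      _ ≤ X * Module.finrank K L * U := h1
      _ ≤ (2 ^ classGroupPRank κ n) ^ n * 2 ^ n * 2 ^ (n * Units.rank K + Nat.log 2 (Units.torsionOrder K)) := by
          rw [hdeg]; exact Nat.mul_le_mul (Nat.mul_le_mul_right _ hX2) hU2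
      _ = 2 ^ (n * classGroupPRank κ n + (n + n * Units.rank K + Nat.log 2 (Units.torsionOrder K))) := by
          rw [← pow_mul, ← pow_add, ← pow_add]; ring_nf
  exact (Nat.pow_le_pow_iff_right (by norm_num : 1 < 2)).mp h5

/-- **Layer `1`: `rank₂ Cl(K_1) ≥ m − 2 − u_K`** when `#μ(K) = 2` (e.g. `K → ℚ₂`): `m ≤ rank₂ Cl(K_1) + 2 + u_K`.
[cite: Gras2003, IV.4] [cite: Lang1990, Ch. 13 §4, Lemma 4.1–4.2] -/
theorem le_classGroupPRank_layer_one_add (κ : ZpExtension K 2) {θ₁ : κ.layer 1} (hθ₁ : θ₁ ^ 2 = 2)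
    (hodd : ∀ w : HeightOneSpectrum (𝓞 K), ((2 : ℕ) : 𝓞 K) ∈ w.asIdeal → Odd (w.asIdeal.ramificationIdx ℤ))
    {m : ℕ} (hm : m ≤ {w : HeightOneSpectrum (𝓞 K) | ((2 : ℕ) : 𝓞 K) ∈ w.asIdeal}.ncard) (hμ : Units.torsionOrder K = 2) :
    m ≤ classGroupPRank κ 1 + 2 + Units.rank K := by
  have h := mul_le_mul_classGroupPRank_layer_add κ hθ₁ hodd hm le_rfl
  rw [hμ, show Nat.log 2 2 = 1 by decide] at h
  simp only [mul_one, one_mul] at h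
  omega

/-- **Layers `n ≥ 2`: `rank₂ Cl(K_n) ≥ m − 1 − u_K`** when `#μ(K) = 2`: `m ≤ rank₂ Cl(K_n) + 1 + u_K` (from `m·n ≤ n·rank + n + n·u + 1` and `2n > n + 1`).
[cite: Gras2003, IV.4] [cite: Washington1997, §13.3 Prop. 13.22–13.23] -/
theorem le_classGroupPRank_layer_add_of_two_le (κ : ZpExtension K 2) {θ₁ : κ.layer 1} (hθ₁ : θ₁ ^ 2 = 2)
    (hodd : ∀ w : HeightOneSpectrum (𝓞 K), ((2 : ℕ) : 𝓞 K) ∈ w.asIdeal → Odd (w.asIdeal.ramificationIdx ℤ))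
    {m : ℕ} (hm : m ≤ {w : HeightOneSpectrum (𝓞 K) | ((2 : ℕ) : 𝓞 K) ∈ w.asIdeal}.ncard) (hμ : Units.torsionOrder K = 2)
    {n : ℕ} (hn : 2 ≤ n) : m ≤ classGroupPRank κ n + 1 + Units.rank K := by
  have h := mul_le_mul_classGroupPRank_layer_add κ hθ₁ hodd hm (by omega : 1 ≤ n)
  rw [hμ, show Nat.log 2 2 = 1 by decide] at h
  by_contra hlt
  have hle : (classGroupPRank κ n + Units.rank K + 2) * n ≤ m * n := Nat.mul_le_mul_right n (by omega)
  have hexp : (classGroupPRank κ n + Units.rank K + 2) * n = n * classGroupPRank κ n + n * Units.rank K + 2 * n := by ring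
  omega

/-- `θ`-free form: `4 ∤ [K:ℚ]`, `κ` cyclotomic, odd indices above `2` ⟹ `m·n ≤ n·rank₂ Cl(K_n) + n + n·u + log₂ #μ(K)` (`√2 ∈ K_1` supplied by the tree's
`exists_sq_eq_two_layer_one_of_forall_sq_ne_two`). [cite: Gras2003, IV.4] [cite: Washington1997, §13.1] -/
theorem mul_le_mul_classGroupPRank_layer_add_of_not_four_dvd (h4 : ¬ 4 ∣ Module.finrank ℚ K) (κ : ZpExtension K 2) (hκ : κ.IsCyclotomic)
    (hodd : ∀ w : HeightOneSpectrum (𝓞 K), ((2 : ℕ) : 𝓞 K) ∈ w.asIdeal → Odd (w.asIdeal.ramificationIdx ℤ))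
    {m : ℕ} (hm : m ≤ {w : HeightOneSpectrum (𝓞 K) | ((2 : ℕ) : 𝓞 K) ∈ w.asIdeal}.ncard) {n : ℕ} (hn : 1 ≤ n) :
    m * n ≤ n * classGroupPRank κ n + (n + n * Units.rank K + Nat.log 2 (Units.torsionOrder K)) := by
  obtain ⟨θ₁, hθ₁⟩ := exists_sq_eq_two_layer_one_of_forall_sq_ne_two h4 (forall_sq_ne_two_of_forall_odd_ramificationIdx hodd) κ hκ
  exact mul_le_mul_classGroupPRank_layer_add κ hθ₁ hodd hm hn

/-- **`K → ℚ₂`, Galois form**: `K/ℚ` Galois with `4 ∤ [K:ℚ]` and a ring map `K → ℚ₂` (so `2` is totally split: `[K:ℚ]` places, all `e = f = 1`, g26; `#μ(K) = 2`,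
p755489), `κ` cyclotomic: **`[K:ℚ] ≤ rank₂ Cl(K_n) + 1 + u_K` for every `n ≥ 2`** and `[K:ℚ] ≤ rank₂ Cl(K_1) + 2 + u_K`.
[cite: Gras2003, IV.4] [cite: NeukirchANT1999, Ch. II §5 (5.7), §8] -/
theorem finrank_le_classGroupPRank_layer_add_of_ringHom_padic [IsGalois ℚ K] (h4 : ¬ 4 ∣ Module.finrank ℚ K) (σ₀ : K →+* ℚ_[2])
    (κ : ZpExtension K 2) (hκ : κ.IsCyclotomic) :
    (Module.finrank ℚ K ≤ classGroupPRank κ 1 + 2 + Units.rank K) ∧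
      ∀ n, 2 ≤ n → Module.finrank ℚ K ≤ classGroupPRank κ n + 1 + Units.rank K := by
  haveI : Fact (Nat.Prime 2) := ⟨Nat.prime_two⟩
  have hodd := forall_odd_ramificationIdx_of_isGalois_of_ringHom_padic (p := 2) σ₀
  have hm : Module.finrank ℚ K ≤ {w : HeightOneSpectrum (𝓞 K) | ((2 : ℕ) : 𝓞 K) ∈ w.asIdeal}.ncard :=
    (ncard_eq_finrank_of_isGalois_of_ringHom_padic (p := 2) σ₀).ge
  have hμ := torsionOrder_eq_two_of_ringHom_padicTwo σ₀
  obtain ⟨θ₁, hθ₁⟩ := exists_sq_eq_two_layer_one_of_forall_sq_ne_two h4 (forall_sq_ne_two_of_forall_odd_ramificationIdx hodd) κ hκ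
  exact ⟨le_classGroupPRank_layer_one_add κ hθ₁ hodd hm hμ, fun n hn => le_classGroupPRank_layer_add_of_two_le κ hθ₁ hodd hm hμ hn⟩

end Tower

/-! ## §2 The sextic `ℚ(W[2])` ON the Kilford stratum: `rank₂ Cl(T_1) ≥ 2`, `rank₂ Cl(T_n) ≥ 3` (`n ≥ 2`), and which RANK certificates can exist -/

section Sextic

open Summit.BirchSwinnertonDyer.BirchSwinnertonDyer.Theorems.AlignedTransportAtTwoKilfordStratumShared

variable (W : WeierstrassCurve ℚ) [W.IsElliptic]

/-- The sextic data fed to §1: `6 ≤ #{w ∣ 2}`, all indices odd, `4 ∤ 6`, `u = 2`, `#μ = 2`. [cite: NeukirchANT1999, Ch. II §8] -/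
private theorem sextic_data (ht : ∀ x : ℚ, ¬ HasRationalTwoTorsionX W x) (hΔ : W.Δ < 0) (hs : OnKilfordStratumAtTwo W) :
    haveI : NumberField (W.divisionField 2) := NumberField.mk
    (¬ 4 ∣ Module.finrank ℚ (W.divisionField 2)) ∧
    (∀ w : HeightOneSpectrum (𝓞 (W.divisionField 2)), ((2 : ℕ) : 𝓞 (W.divisionField 2)) ∈ w.asIdeal → Odd (w.asIdeal.ramificationIdx ℤ)) ∧
    6 ≤ {w : HeightOneSpectrum (𝓞 (W.divisionField 2)) | ((2 : ℕ) : 𝓞 (W.divisionField 2)) ∈ w.asIdeal}.ncard ∧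
    Units.rank (W.divisionField 2) = 2 ∧ Units.torsionOrder (W.divisionField 2) = 2 := by
  haveI : NumberField (W.divisionField 2) := NumberField.mk
  have hsq : ¬ IsSquare W.Δ := fun ⟨r, hr⟩ ↦ by nlinarith [mul_self_nonneg r]
  refine ⟨by rw [finrank_divisionField_two_eq_six W ht hsq]; decide, fun w hw ↦ ?_,
    (ncard_primes_divisionField_two_eq_six W ht hsq hs).ge, units_rank_divisionField_two W ht hΔ, torsionOrder_divisionField_two_eq_two W hs⟩
  rw [(ramificationIdx_eq_one_and_inertiaDeg_eq_one_divisionField_two W hs w hw).1]; exact odd_one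

/-- **`6n ≤ n·rank₂ Cl(ℚ(W[2])_n) + 3n + 1`** along every cyclotomic `ℤ₂`-extension of the sextic `ℚ(W[2])` (`W` with no rational `2`-torsion abscissa,
`Δ_W < 0`, ON the Kilford stratum; `n ≥ 1`). [cite: Gras2003, IV.4] [cite: Lang1990, Ch. 13 §4, Lemma 4.1–4.2] -/
theorem six_mul_le_classGroupPRank_layer_divisionField_two (ht : ∀ x : ℚ, ¬ HasRationalTwoTorsionX W x) (hΔ : W.Δ < 0)
    (hs : OnKilfordStratumAtTwo W) (κ : ZpExtension (W.divisionField 2) 2) (hκ : κ.IsCyclotomic) {n : ℕ} (hn : 1 ≤ n) :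
    6 * n ≤ n * classGroupPRank κ n + 3 * n + 1 := by
  haveI : NumberField (W.divisionField 2) := NumberField.mk
  obtain ⟨h4, hodd, h6, hu, hμ⟩ := sextic_data W ht hΔ hs
  have h := mul_le_mul_classGroupPRank_layer_add_of_not_four_dvd h4 κ hκ hodd h6 hn
  rw [hu, hμ, show Nat.log 2 2 = 1 by decide] at h
  omega

/-- ★ **`rank₂ Cl(ℚ(W[2])_1) ≥ 2`** — the first layer `T_1 = T(√2)` (degree `12`) of every cyclotomic `ℤ₂`-extension of the sextic `T = ℚ(W[2])` ON the Kilford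
stratum (`Δ_W < 0`, no rational `2`-torsion abscissa) has `2`-class rank at least `2`: six ramified primes, `[E_T : E_T²] = 8`.
[cite: Gras2003, IV.4] [cite: Lang1990, Ch. 13 §4, Lemma 4.1–4.2] -/
theorem two_le_classGroupPRank_layer_one_divisionField_two (ht : ∀ x : ℚ, ¬ HasRationalTwoTorsionX W x) (hΔ : W.Δ < 0)
    (hs : OnKilfordStratumAtTwo W) (κ : ZpExtension (W.divisionField 2) 2) (hκ : κ.IsCyclotomic) : 2 ≤ classGroupPRank κ 1 := by
  have h := six_mul_le_classGroupPRank_layer_divisionField_two W ht hΔ hs κ hκ le_rfl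
  omega

/-- ★ **`rank₂ Cl(ℚ(W[2])_n) ≥ 3` for every `n ≥ 2`** along every cyclotomic `ℤ₂`-extension of the sextic ON the Kilford stratum (`Δ_W < 0`): the genus
group of `T_n/T` is killed by `2ⁿ` and has order `≥ 2^{3n−1}`. [cite: Gras2003, IV.4] [cite: Washington1997, §13.3 Prop. 13.22–13.23] -/
theorem three_le_classGroupPRank_layer_divisionField_two (ht : ∀ x : ℚ, ¬ HasRationalTwoTorsionX W x) (hΔ : W.Δ < 0)
    (hs : OnKilfordStratumAtTwo W) (κ : ZpExtension (W.divisionField 2) 2) (hκ : κ.IsCyclotomic) {n : ℕ} (hn : 2 ≤ n) :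
    3 ≤ classGroupPRank κ n := by
  have h := six_mul_le_classGroupPRank_layer_divisionField_two W ht hΔ hs κ hκ (by omega : 1 ≤ n)
  by_contra hlt
  have hle : n * classGroupPRank κ n ≤ n * 2 := Nat.mul_le_mul_left n (by omega)
  omega

/-- **A layer-(0,1) RANK certificate needs `rank₂ Cl(ℚ(W[2])) ≥ 2`**: if `r_0 = r_1` (Fukuda's Thm. 1 (2) hypothesis at the pair `(0,1)`, the only admissible
`μ`-certificate shape on the Kilford sub-cell — g26/REF1 R280c) then `rank₂ Cl(ℚ(W[2])) ≥ 2`.  So for a seed with `h(ℚ(W[2]))` odd or `rank₂ = 1` the census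
must start at the pair `(1,2)` (degrees `12`, `24`). [cite: Fukuda1994, Thm. 1 (2), p. 264] [cite: Gras2003, IV.4] -/
theorem two_le_classGroupPRank_zero_of_rankCert_zero (ht : ∀ x : ℚ, ¬ HasRationalTwoTorsionX W x) (hΔ : W.Δ < 0)
    (hs : OnKilfordStratumAtTwo W) (κ : ZpExtension (W.divisionField 2) 2) (hκ : κ.IsCyclotomic)
    (hcert : classGroupPRank κ 0 = classGroupPRank κ 1) : 2 ≤ classGroupPRank κ 0 := by
  rw [hcert]; exact two_le_classGroupPRank_layer_one_divisionField_two W ht hΔ hs κ hκ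

/-- **A RANK certificate at a pair `(n, n+1)` with `n ≥ 1` needs `r_n ≥ 3`** (`r_n = r_{n+1} ≥ 3`). [cite: Fukuda1994, Thm. 1 (2), p. 264] [cite: Gras2003, IV.4] -/
theorem three_le_classGroupPRank_of_rankCert_succ (ht : ∀ x : ℚ, ¬ HasRationalTwoTorsionX W x) (hΔ : W.Δ < 0)
    (hs : OnKilfordStratumAtTwo W) (κ : ZpExtension (W.divisionField 2) 2) (hκ : κ.IsCyclotomic) {n : ℕ} (hn : 1 ≤ n)
    (hcert : classGroupPRank κ n = classGroupPRank κ (n + 1)) : 3 ≤ classGroupPRank κ n := by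
  rw [hcert]; exact three_le_classGroupPRank_layer_divisionField_two W ht hΔ hs κ hκ (by omega)

/-- **The small-rank door L10 at `(p, j) = (2, 2)` is VOID on the sextic**: `rank₂ Cl(ℚ(W[2])_2) < 2² − 1 = 3` (the hypothesis of the tree's
`classGroupPRank_le_of_lt_pow_sub_one` at `n = 0`, `j = 2`) never holds ON the Kilford stratum. [cite: Washington1997, §13.3 Prop. 13.23] [cite: Gras2003, IV.4] -/
theorem not_classGroupPRank_layer_two_lt_three_divisionField_two (ht : ∀ x : ℚ, ¬ HasRationalTwoTorsionX W x) (hΔ : W.Δ < 0)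
    (hs : OnKilfordStratumAtTwo W) (κ : ZpExtension (W.divisionField 2) 2) (hκ : κ.IsCyclotomic) :
    ¬ classGroupPRank κ (0 + 2) < 2 ^ 2 - 1 := by
  have h := three_le_classGroupPRank_layer_divisionField_two W ht hΔ hs κ hκ (le_rfl : 2 ≤ 2)
  norm_num
  exact h

variable [W.IsGloballyMinimal]

/-- The `Δ_min ≡ 1 (mod 8)` form (globally minimal `W`, good ordinary at `2`) of `rank₂ Cl(ℚ(W[2])_1) ≥ 2`. [cite: Gras2003, IV.4]
[cite: Serre1973, Ch. II §3.3 Thm. 4] -/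
theorem two_le_classGroupPRank_layer_one_divisionField_two_of_minimalDiscriminantInt_emod_eight (hord : IsOrdinaryAt W 2)
    (ht : ∀ x : ℚ, ¬ HasRationalTwoTorsionX W x) (hΔ : W.Δ < 0) (h8 : minimalDiscriminantInt W % 8 = 1)
    (κ : ZpExtension (W.divisionField 2) 2) (hκ : κ.IsCyclotomic) : 2 ≤ classGroupPRank κ 1 :=
  two_le_classGroupPRank_layer_one_divisionField_two W ht hΔ ((onKilfordStratumAtTwo_iff_minimalDiscriminantInt_emod_eight W hord).mpr h8) κ hκ

/-- The `Δ_min ≡ 1 (mod 8)` form of `rank₂ Cl(ℚ(W[2])_n) ≥ 3` (`n ≥ 2`). [cite: Gras2003, IV.4] [cite: Serre1973, Ch. II §3.3 Thm. 4] -/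
theorem three_le_classGroupPRank_layer_divisionField_two_of_minimalDiscriminantInt_emod_eight (hord : IsOrdinaryAt W 2)
    (ht : ∀ x : ℚ, ¬ HasRationalTwoTorsionX W x) (hΔ : W.Δ < 0) (h8 : minimalDiscriminantInt W % 8 = 1)
    (κ : ZpExtension (W.divisionField 2) 2) (hκ : κ.IsCyclotomic) {n : ℕ} (hn : 2 ≤ n) : 3 ≤ classGroupPRank κ n :=
  three_le_classGroupPRank_layer_divisionField_two W ht hΔ ((onKilfordStratumAtTwo_iff_minimalDiscriminantInt_emod_eight W hord).mpr h8) κ hκ hn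

/-- The `Δ_min ≡ 1 (mod 8)` form of the R280a kernel `e_0 + 3n ≤ e_n + 1`. [cite: Lang1990, Ch. 13 §4, Lemma 4.1–4.2] [cite: Serre1973, Ch. II §3.3 Thm. 4] -/
theorem classNumberPExp_zero_add_three_mul_le_layer_succ_divisionField_two_of_minimalDiscriminantInt_emod_eight (hord : IsOrdinaryAt W 2)
    (ht : ∀ x : ℚ, ¬ HasRationalTwoTorsionX W x) (hΔ : W.Δ < 0) (h8 : minimalDiscriminantInt W % 8 = 1)
    (κ : ZpExtension (W.divisionField 2) 2) (hκ : κ.IsCyclotomic) (n : ℕ) : classNumberPExp κ 0 + 3 * n ≤ classNumberPExp κ n + 1 :=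
  classNumberPExp_zero_add_three_mul_le_layer_succ_divisionField_two W ht hΔ
    ((onKilfordStratumAtTwo_iff_minimalDiscriminantInt_emod_eight W hord).mpr h8) κ hκ n

end Sextic

end Summit.BirchSwinnertonDyer.BirchSwinnertonDyer.Theorems.AlignedTransportAtTwoSexticTowerRank
end
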